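import Mathlib
import Summits.ValiantsHypothesis.ValiantsHypothesis.Theorems.LiouvilleSarnakLiouvilleCutRankSignPatternsTools

/-!
# Route LiouvilleSarnak — crux `LiouvilleCutRank` (stmt-ValiantsHypothesis-14775): the THRESHOLD MINOR — a
# polynomial-size witness matrix of `λ` at the WINDOW NUMBERS of the cut word (route-independent tools)

The crux asks for the rank of the `2^n × 2^n` matrix `M_π = (λ(N_π(r,c)+1))_{r,c}`.  This file isolates its
`(n+1) × (n+1)` THRESHOLD MINOR `T_π`: rows `𝟙[row position < a]` (`a` a row position, or `a = 2n`: all ones),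
columns `𝟙[column position < b]` (`b` a column position or `2n`), and computes its entries in closed form:

* `sum_two_pow_positions_lt` — the positions below `a` (rows and columns together) carry `Σ_{j<a} 2^j = 2^a - 1`.
* ★ `liouville_threshold_entry_lt` — for `a < b`: `M_π(𝟙[ρ<a], 𝟙[γ<b]) = (-1)^a · λ(1 + Σ_{a<γ_k<b} 2^{γ_k - a})`,
  i.e. `N + 1 = 2^a · Q_π(a,b)` where `Q_π(a,b)` is the odd number whose binary digits are `1` followed by the
  COLUMN-indicator of the window `(a, b)` of the cut word (`liouville_threshold_succ_eq`);
  `liouville_threshold_entry_gt` — for `b < a` symmetrically `(-1)^b · λ(1 + Σ_{b<ρ_i<a} 2^{ρ_i - b})` (row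
  indicator of the window `(b, a)`).  So `T_π[a,b] = (-1)^{min(a,b)} λ(Q_π(a,b))`, `Q_π(a,b) < 2^{|b-a|}`: the
  entries near the diagonal are `λ` at SMALL numbers read off short windows of the word (for the two-adic twin
  `f₀` all `Q`-factors are `1` and `T_π` is the `(-1)^{min}` matrix of `…TwoAdicTwinRuns`, p831209).
* `rank_thresholdMinor_le_rank` — `rank T_π ≤ rank M_π` (submatrix); the BY-NAME reduction of the crux to the
  threshold minors of many-changes words is in the companion file `…ThresholdMinor.lean` (which imports the
  route file; this one does not).

Reading (census evidence of this hand, numerics/threshold_minor.py): on every tested word up to `2n = 22`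
(`(CR)^n`, `(CCRR)^m`, Thue–Morse prefixes, random words with runs `≤ 2, ≤ 3`, random words, aligned `R^nC^n`)
`rank T_π ≥ min(#rows, #cols) - 2`, i.e. the threshold minor alone already carries rank `≍ n` — so the crux
"lives" in an explicit polynomial-size `±1` matrix of `λ`-values at window numbers (for `(CR)^n` it is the
Toeplitz matrix with symbol `d ↦ λ((2·4^d+1)/3)`, the Wagstaff numbers).  Honest framing: a reformulation and a
tool; no case of the crux is closed here; `LiouvilleCutRank`, `DigitalBilinearLiouville`, `AlgebraicSarnak` stay
OPEN; nothing bears on `VP ≠ VNP`.  No definitions (threshold rows/columns are explicit `decide` terms); imports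
only the route-independent `…SignPatternsTools` (digit sums).
-/

set_option linter.dupNamespace false

noncomputable section

namespace Summit.ValiantsHypothesis.ValiantsHypothesis.Theorems.LiouvilleSarnakLiouvilleCutRank.ThresholdMinorTools

open ArithmeticFunction Finset

open Summit.ValiantsHypothesis.ValiantsHypothesis.Theorems.LiouvilleSarnakLiouvilleCutRank.SignPatterns
  (ofBits_cut_eq_add ofBits_rows_eq_sum ofBits_cols_eq_sum)

/-! ### §1 Digit bookkeeping for threshold rows and columns -/

/-- **Positions below `a`.**  For a cut `π` of the `2n` positions and `a ≤ 2n`, the row positions below `a` and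
the column positions below `a` together carry `Σ_{j<a} 2^j = 2^a - 1`. [this file] -/
theorem sum_two_pow_positions_lt (n : ℕ) (π : Fin n ⊕ Fin n ≃ Fin (2 * n)) (a : ℕ) (ha : a ≤ 2 * n) :
    (∑ i : Fin n, if (π (Sum.inl i) : ℕ) < a then 2 ^ (π (Sum.inl i) : ℕ) else 0) +
      (∑ i : Fin n, if (π (Sum.inr i) : ℕ) < a then 2 ^ (π (Sum.inr i) : ℕ) else 0) = 2 ^ a - 1 := by
  have h1 : (∑ i : Fin n, if (π (Sum.inl i) : ℕ) < a then 2 ^ (π (Sum.inl i) : ℕ) else 0) +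
      (∑ i : Fin n, if (π (Sum.inr i) : ℕ) < a then 2 ^ (π (Sum.inr i) : ℕ) else 0) =
      ∑ x : Fin n ⊕ Fin n, if (π x : ℕ) < a then 2 ^ (π x : ℕ) else 0 := by
    rw [Fintype.sum_sum_type]
  rw [h1, Fintype.sum_equiv π (fun x => if (π x : ℕ) < a then 2 ^ (π x : ℕ) else 0)
    (fun j : Fin (2 * n) => if (j : ℕ) < a then 2 ^ (j : ℕ) else 0) (fun x => rfl)]
  rw [Fin.sum_univ_eq_sum_range (fun j => if j < a then 2 ^ j else 0) (2 * n)]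
  have hgeom : ∑ j ∈ range a, 2 ^ j = 2 ^ a - 1 := by
    rw [Nat.geomSum_eq (le_refl 2) a]
    simp
  rw [← hgeom, Finset.sum_ite, Finset.sum_const_zero, add_zero]
  congr 1
  ext j
  simp only [mem_filter, mem_range]
  omega

/-- `(decide p).toNat * x = if p then x else 0`. [folklore] -/
theorem toNat_decide_mul (p : Prop) [Decidable p] (x : ℕ) : (decide p).toNat * x = if p then x else 0 := by
  by_cases hp : p <;> simp [hp]

/-- ★ **The number behind a threshold entry (`a < b`).**  If `a < b ≤ 2n` and `a` is not a column position, the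
cut number `N` of the row `𝟙[row position < a]` against the column `𝟙[column position < b]` satisfies
`N + 1 = 2^a · (1 + Σ_{k : a < γ_k < b} 2^{γ_k - a})` (`γ_k` the column positions): all bits below `a` are `1`,
bit `a` is `0`, and above `a` exactly the column bits of the window `(a, b)` are set. [this file] -/
theorem threshold_succ_eq (n : ℕ) (π : Fin n ⊕ Fin n ≃ Fin (2 * n)) (a b : ℕ) (hab : a < b)
    (hb : b ≤ 2 * n) (haC : ∀ k : Fin n, (π (Sum.inr k) : ℕ) ≠ a) :
    Nat.ofBits (fun j : Fin (2 * n) =>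
        Sum.elim (fun i : Fin n => decide ((π (Sum.inl i) : ℕ) < a))
          (fun k : Fin n => decide ((π (Sum.inr k) : ℕ) < b)) (π.symm j)) + 1 =
      2 ^ a * (1 + ∑ k : Fin n,
        if a < (π (Sum.inr k) : ℕ) ∧ (π (Sum.inr k) : ℕ) < b then 2 ^ ((π (Sum.inr k) : ℕ) - a) else 0) := by
  rw [ofBits_cut_eq_add, ofBits_rows_eq_sum, ofBits_cols_eq_sum]
  simp only [toNat_decide_mul]
  -- split the column sum at `a`
  have hsplit : (∑ k : Fin n, if (π (Sum.inr k) : ℕ) < b then 2 ^ (π (Sum.inr k) : ℕ) else 0) =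
      (∑ k : Fin n, if (π (Sum.inr k) : ℕ) < a then 2 ^ (π (Sum.inr k) : ℕ) else 0) +
        ∑ k : Fin n, if a < (π (Sum.inr k) : ℕ) ∧ (π (Sum.inr k) : ℕ) < b then 2 ^ (π (Sum.inr k) : ℕ) else 0 := by
    rw [← sum_add_distrib]
    refine sum_congr rfl fun k _ => ?_
    have hk := haC k
    by_cases h1 : (π (Sum.inr k) : ℕ) < a
    · rw [if_pos (lt_trans h1 hab), if_pos h1, if_neg (by omega), add_zero]
    · by_cases h2 : (π (Sum.inr k) : ℕ) < b
      · rw [if_pos h2, if_neg h1, if_pos ⟨by omega, h2⟩, zero_add]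
      · rw [if_neg h2, if_neg h1, if_neg (by omega), add_zero]
  -- the window part is divisible by `2^a`
  have hwin : (∑ k : Fin n,
      if a < (π (Sum.inr k) : ℕ) ∧ (π (Sum.inr k) : ℕ) < b then 2 ^ (π (Sum.inr k) : ℕ) else 0) =
      2 ^ a * ∑ k : Fin n,
        if a < (π (Sum.inr k) : ℕ) ∧ (π (Sum.inr k) : ℕ) < b then 2 ^ ((π (Sum.inr k) : ℕ) - a) else 0 := by
    rw [mul_sum]
    refine sum_congr rfl fun k _ => ?_
    split_ifs with h
    · rw [← pow_add]; congr 1; omega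
    · rfl
  rw [hsplit, ← add_assoc, sum_two_pow_positions_lt n π a (by omega), hwin]
  have := Nat.one_le_two_pow (n := a)
  zify [this]
  ring

/-- ★ **Threshold entries, `a < b`.**  For `a < b ≤ 2n`, `a` not a column position:
`λ(N + 1) = (-1)^a · λ(1 + Σ_{a < γ_k < b} 2^{γ_k - a})` — `λ` at the WINDOW NUMBER of `(a, b)` (the odd number
`1·(column pattern of the window)` in binary, `< 2^{b-a}`). [this file] -/
theorem liouville_threshold_entry_lt (n : ℕ) (π : Fin n ⊕ Fin n ≃ Fin (2 * n)) (a b : ℕ) (hab : a < b)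
    (hb : b ≤ 2 * n) (haC : ∀ k : Fin n, (π (Sum.inr k) : ℕ) ≠ a) :
    (((liouville (Nat.ofBits (fun j : Fin (2 * n) =>
        Sum.elim (fun i : Fin n => decide ((π (Sum.inl i) : ℕ) < a))
          (fun k : Fin n => decide ((π (Sum.inr k) : ℕ) < b)) (π.symm j)) + 1) : ℤ) : ℂ)) =
      (-1 : ℂ) ^ a * (((liouville (1 + ∑ k : Fin n,
        if a < (π (Sum.inr k) : ℕ) ∧ (π (Sum.inr k) : ℕ) < b then 2 ^ ((π (Sum.inr k) : ℕ) - a) else 0)) :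
          ℤ) : ℂ) := by
  rw [threshold_succ_eq n π a b hab hb haC, liouville_apply_mul, liouville_apply (pow_ne_zero _ two_ne_zero),
    cardFactors_apply_prime_pow Nat.prime_two]
  push_cast
  ring

/-- **Threshold entries, `b < a`.**  For `b < a ≤ 2n`, `b` not a row position:
`λ(N + 1) = (-1)^b · λ(1 + Σ_{b < ρ_i < a} 2^{ρ_i - b})` (the ROW pattern of the window `(b, a)`); by the swapped
cut from `liouville_threshold_entry_lt`. [this file] -/
theorem liouville_threshold_entry_gt (n : ℕ) (π : Fin n ⊕ Fin n ≃ Fin (2 * n)) (a b : ℕ) (hba : b < a)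
    (ha : a ≤ 2 * n) (hbR : ∀ i : Fin n, (π (Sum.inl i) : ℕ) ≠ b) :
    (((liouville (Nat.ofBits (fun j : Fin (2 * n) =>
        Sum.elim (fun i : Fin n => decide ((π (Sum.inl i) : ℕ) < a))
          (fun k : Fin n => decide ((π (Sum.inr k) : ℕ) < b)) (π.symm j)) + 1) : ℤ) : ℂ)) =
      (-1 : ℂ) ^ b * (((liouville (1 + ∑ i : Fin n,
        if b < (π (Sum.inl i) : ℕ) ∧ (π (Sum.inl i) : ℕ) < a then 2 ^ ((π (Sum.inl i) : ℕ) - b) else 0)) :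
          ℤ) : ℂ) := by
  -- the swapped cut: rows and columns exchanged
  set π' : Fin n ⊕ Fin n ≃ Fin (2 * n) := (Equiv.sumComm (Fin n) (Fin n)).trans π with hπ'
  have hinl : ∀ i : Fin n, π' (Sum.inl i) = π (Sum.inr i) := fun i => rfl
  have hinr : ∀ i : Fin n, π' (Sum.inr i) = π (Sum.inl i) := fun i => rfl
  have h := liouville_threshold_entry_lt n π' b a hba ha (fun k => by rw [hinr]; exact hbR k)
  simp only [hinl, hinr] at h
  have hfun : (fun j : Fin (2 * n) =>
      Sum.elim (fun i : Fin n => decide ((π (Sum.inr i) : ℕ) < b))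
        (fun k : Fin n => decide ((π (Sum.inl k) : ℕ) < a)) (π'.symm j)) =
      fun j : Fin (2 * n) =>
        Sum.elim (fun i : Fin n => decide ((π (Sum.inl i) : ℕ) < a))
          (fun k : Fin n => decide ((π (Sum.inr k) : ℕ) < b)) (π.symm j) := by
    funext j
    simp only [hπ', Equiv.symm_trans_apply, Equiv.sumComm_symm, Equiv.sumComm_apply]
    cases π.symm j <;> rfl
  rw [hfun] at h
  exact h

/-! ### §2 The threshold minor and the reduction of the crux -/

/-- **`rank T_π ≤ rank M_π`.**  The threshold minor — rows `𝟙[ρ < ρ_{i₀}]` (`i₀ : Fin n`) and the all-ones row,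
columns `𝟙[γ < γ_{k₀}]` and the all-ones column, an `(n+1) × (n+1)` matrix indexed by `Option (Fin n)` — is a
submatrix of the cut matrix. [folklore] -/
theorem rank_thresholdMinor_le_rank (n : ℕ) (π : Fin n ⊕ Fin n ≃ Fin (2 * n)) :
    ((Matrix.of fun r c : Fin n → Bool =>
        (((liouville (Nat.ofBits (fun k : Fin (2 * n) => Sum.elim r c (π.symm k)) + 1) : ℤ) : ℂ))).submatrix
      (fun o : Option (Fin n) => fun i : Fin n =>
        o.elim true fun i₀ => decide ((π (Sum.inl i) : ℕ) < (π (Sum.inl i₀) : ℕ)))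
      (fun o : Option (Fin n) => fun k : Fin n =>
        o.elim true fun k₀ => decide ((π (Sum.inr k) : ℕ) < (π (Sum.inr k₀) : ℕ)))).rank ≤
    (Matrix.of fun r c : Fin n → Bool =>
        (((liouville (Nat.ofBits (fun k : Fin (2 * n) => Sum.elim r c (π.symm k)) + 1) : ℤ) : ℂ))).rank :=
  Matrix.rank_submatrix_le _ _ _

/-- **Entries of the threshold minor (interior, `ρ_{i₀} < γ_{k₀}`).**  The `(some i₀, some k₀)` entry of the
threshold minor with `ρ_{i₀} < γ_{k₀}` is `(-1)^{ρ_{i₀}} λ(1 + Σ_{ρ_{i₀} < γ_k < γ_{k₀}} 2^{γ_k - ρ_{i₀}})`.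
[this file] -/
theorem thresholdMinor_entry_lt (n : ℕ) (π : Fin n ⊕ Fin n ≃ Fin (2 * n)) (i₀ k₀ : Fin n)
    (hlt : (π (Sum.inl i₀) : ℕ) < (π (Sum.inr k₀) : ℕ)) :
    ((Matrix.of fun r c : Fin n → Bool =>
        (((liouville (Nat.ofBits (fun k : Fin (2 * n) => Sum.elim r c (π.symm k)) + 1) : ℤ) : ℂ))).submatrix
      (fun o : Option (Fin n) => fun i : Fin n =>
        o.elim true fun i₀ => decide ((π (Sum.inl i) : ℕ) < (π (Sum.inl i₀) : ℕ)))
      (fun o : Option (Fin n) => fun k : Fin n =>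
        o.elim true fun k₀ => decide ((π (Sum.inr k) : ℕ) < (π (Sum.inr k₀) : ℕ)))) (some i₀) (some k₀) =
      (-1 : ℂ) ^ (π (Sum.inl i₀) : ℕ) * (((liouville (1 + ∑ k : Fin n,
        if (π (Sum.inl i₀) : ℕ) < (π (Sum.inr k) : ℕ) ∧ (π (Sum.inr k) : ℕ) < (π (Sum.inr k₀) : ℕ) then
          2 ^ ((π (Sum.inr k) : ℕ) - (π (Sum.inl i₀) : ℕ)) else 0)) : ℤ) : ℂ) := by
  have hRC : ∀ k : Fin n, (π (Sum.inr k) : ℕ) ≠ (π (Sum.inl i₀) : ℕ) := by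
    intro k h
    have h' : π (Sum.inr k) = π (Sum.inl i₀) := Fin.ext h
    exact Sum.inr_ne_inl (π.injective h')
  simp only [Matrix.submatrix_apply, Matrix.of_apply, Option.elim]
  exact liouville_threshold_entry_lt n π _ _ hlt (π (Sum.inr k₀)).isLt.le hRC

/-- **Entries of the threshold minor (interior, `γ_{k₀} < ρ_{i₀}`).**  Symmetrically
`(-1)^{γ_{k₀}} λ(1 + Σ_{γ_{k₀} < ρ_i < ρ_{i₀}} 2^{ρ_i - γ_{k₀}})`. [this file] -/
theorem thresholdMinor_entry_gt (n : ℕ) (π : Fin n ⊕ Fin n ≃ Fin (2 * n)) (i₀ k₀ : Fin n)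
    (hgt : (π (Sum.inr k₀) : ℕ) < (π (Sum.inl i₀) : ℕ)) :
    ((Matrix.of fun r c : Fin n → Bool =>
        (((liouville (Nat.ofBits (fun k : Fin (2 * n) => Sum.elim r c (π.symm k)) + 1) : ℤ) : ℂ))).submatrix
      (fun o : Option (Fin n) => fun i : Fin n =>
        o.elim true fun i₀ => decide ((π (Sum.inl i) : ℕ) < (π (Sum.inl i₀) : ℕ)))
      (fun o : Option (Fin n) => fun k : Fin n =>
        o.elim true fun k₀ => decide ((π (Sum.inr k) : ℕ) < (π (Sum.inr k₀) : ℕ)))) (some i₀) (some k₀) =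
      (-1 : ℂ) ^ (π (Sum.inr k₀) : ℕ) * (((liouville (1 + ∑ i : Fin n,
        if (π (Sum.inr k₀) : ℕ) < (π (Sum.inl i) : ℕ) ∧ (π (Sum.inl i) : ℕ) < (π (Sum.inl i₀) : ℕ) then
          2 ^ ((π (Sum.inl i) : ℕ) - (π (Sum.inr k₀) : ℕ)) else 0)) : ℤ) : ℂ) := by
  have hCR : ∀ i : Fin n, (π (Sum.inl i) : ℕ) ≠ (π (Sum.inr k₀) : ℕ) := by
    intro i h
    have h' : π (Sum.inl i) = π (Sum.inr k₀) := Fin.ext h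
    exact Sum.inl_ne_inr (π.injective h')
  simp only [Matrix.submatrix_apply, Matrix.of_apply, Option.elim]
  exact liouville_threshold_entry_gt n π _ _ hgt (π (Sum.inl i₀)).isLt.le hCR

end Summit.ValiantsHypothesis.ValiantsHypothesis.Theorems.LiouvilleSarnakLiouvilleCutRank.ThresholdMinorTools

end
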